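import Mathlib
import HarnessLib
import Summits.Ventures.LatticeQCDFlow.Scaling.AutoregressiveBondFaithful

/-!
# LatticeQCDFlow / Scaling — the ring, lower half completed: the exact autoregressive conditional of
# site `k` on `ℤ/(n+2)` also reads its retained NEIGHBOUR `k+1` (GEN-16's bond theorem instantiated)

HONEST FRAMING: exact (Metropolis-corrected) sampling algorithms for lattice gauge theory;
figures of merit are autocorrelation/cost numbers at stated couplings and volumes; no
continuum-physics claim.

Venture `LatticeQCDFlow` (cell pub-lqcd), topic `Scaling`, FANOUT row 30 (lean-1, GEN-17) — OUR WORK,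
companion of `Scaling/AutoregressiveRingFaithful` (site `k` reads the LAST site through the integrated
block).  Here the other frontier variable: with the same ring weight
`w = ∏_i g_i(φ_i) · ∏_l b_l(φ_l, φ_{l+1}) · bc(φ_{n+1}, φ_0)`, generating from the top with
`s = {i | i < k}` integrated and `k + 1 < n + 1`, the exact conditional of site `k` READS the retained
neighbour `k + 1` whenever the bond `b_k` is not of product form — GEN-16's
`arConditional_reads_bond` with the sorting `F = b_k`, `w₁ = (∏_{i≤k} g_i)(∏_{l<k} b_l)·bc` (blind to
`k+1`), `w₂ = (∏_{i>k} g_i)(∏_{l>k} b_l)` (blind to `k` and to the block).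

* **`ring_arConditional_reads_next`** — positive bounded measurable factors, any reference probability
  measure, `b_k u t · b_k u' t' ≠ b_k u t' · b_k u' t` for some values ⇒ two configurations agreeing off
  `k + 1` with different conditionals `A_s w / A_{insert k s} w`.

With `AutoregressiveRingFaithful` (reads `n+1`) this types the whole LOWER half of "the context of `k`
on the ring is exactly its fill-neighbourhood `{k+1, n+1}`"; the upper half (nothing else is read) is
the frontier bound of `Scaling/AutoregressiveMarkovContext`, not instantiated here.  NOT CLAIMED:
anything beyond the ring; any number of ours.  Elementary; no `def`; nothing cited as a fact; no `sorry`.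
-/

noncomputable section

namespace Summit.Ventures.LatticeQCDFlow.Theory2.Autoregressive

open MeasureTheory Function Set
open Summit.Ventures.LatticeQCDFlow.Exactness

variable {X : Type*} [MeasurableSpace X] (μ : Measure X) [IsProbabilityMeasure μ] {n : ℕ}

/-- **ON THE RING THE EXACT CONDITIONAL OF SITE `k` READS ITS RETAINED NEIGHBOUR `k + 1`** (sites
`Fin (n+2)`, chain bonds `b_l`, closing bond `bc`, site factors `g_i`, all positive bounded measurable;
any reference probability measure; `s = {i | i < k}` integrated; `k + 1 < n + 1`): if
`b_k u t · b_k u' t' ≠ b_k u t' · b_k u' t` for some values then there are two configurations agreeing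
off `k + 1` on which `A_s w / A_{insert k s} w` differs. [ours] -/
theorem ring_arConditional_reads_next (g : Fin (n + 2) → X → ℝ) (b : Fin (n + 1) → X → X → ℝ)
    (bc : X → X → ℝ) (hgm : ∀ i, Measurable (g i)) (hbm : ∀ l, Measurable (uncurry (b l)))
    (hbcm : Measurable (uncurry bc)) (hgpos : ∀ i v, 0 < g i v) (hbpos : ∀ l v v', 0 < b l v v')
    (hbcpos : ∀ v v', 0 < bc v v') (hgbdd : ∀ i, ∃ C, ∀ v, g i v ≤ C)
    (hbbdd : ∀ l, ∃ C, ∀ v v', b l v v' ≤ C) (hbcbdd : ∃ C, ∀ v v', bc v v' ≤ C)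
    (k : Fin (n + 1)) (hk : k.val < n) [Nonempty X] {u u' t t' : X}
    (hF : b k u t * b k u' t' ≠ b k u t' * b k u' t) :
    ∃ ψ ψ' : Fin (n + 2) → X, (∀ i, i ≠ k.succ → ψ i = ψ' i) ∧
      coordAvg μ (Finset.univ.filter (· < k.castSucc))
            (fun φ => (∏ i, g i (φ i)) * (∏ l : Fin (n + 1), b l (φ l.castSucc) (φ l.succ)) *
              bc (φ (Fin.last (n + 1))) (φ 0)) ψ /
          coordAvg μ (insert k.castSucc (Finset.univ.filter (· < k.castSucc)))
            (fun φ => (∏ i, g i (φ i)) * (∏ l : Fin (n + 1), b l (φ l.castSucc) (φ l.succ)) *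
              bc (φ (Fin.last (n + 1))) (φ 0)) ψ ≠
        coordAvg μ (Finset.univ.filter (· < k.castSucc))
            (fun φ => (∏ i, g i (φ i)) * (∏ l : Fin (n + 1), b l (φ l.castSucc) (φ l.succ)) *
              bc (φ (Fin.last (n + 1))) (φ 0)) ψ' /
          coordAvg μ (insert k.castSucc (Finset.univ.filter (· < k.castSucc)))
            (fun φ => (∏ i, g i (φ i)) * (∏ l : Fin (n + 1), b l (φ l.castSucc) (φ l.succ)) *
              bc (φ (Fin.last (n + 1))) (φ 0)) ψ' := by
  classical
  set m : ℕ := k.val with hmdef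
  set a : Fin (n + 2) := k.castSucc with hadef
  set j : Fin (n + 2) := k.succ with hjdef
  set s : Finset (Fin (n + 2)) := Finset.univ.filter (· < a) with hsdef
  have ha_val : a.val = m := by simp [hadef, hmdef]
  have hj_val : j.val = m + 1 := by simp [hjdef, hmdef]
  have hmem_s : ∀ i : Fin (n + 2), i ∈ s ↔ i.val < m := by
    intro i; simp [hsdef, Fin.lt_def, ha_val]
  -- the sorting `w = F · w₁ · w₂`
  let w₁ : (Fin (n + 2) → X) → ℝ := fun η =>
    (∏ i ∈ Finset.univ.filter (fun i : Fin (n + 2) => i.val ≤ m), g i (η i)) *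
      (∏ l ∈ Finset.univ.filter (fun l : Fin (n + 1) => l.val < m), b l (η l.castSucc) (η l.succ)) *
      bc (η (Fin.last (n + 1))) (η 0)
  let w₂ : (Fin (n + 2) → X) → ℝ := fun η =>
    (∏ i ∈ Finset.univ.filter (fun i : Fin (n + 2) => m + 1 ≤ i.val), g i (η i)) *
      ∏ l ∈ Finset.univ.filter (fun l : Fin (n + 1) => m + 1 ≤ l.val), b l (η l.castSucc) (η l.succ)
  have hsite : ∀ η : Fin (n + 2) → X, ∏ i, g i (η i) =
      (∏ i ∈ Finset.univ.filter (fun i : Fin (n + 2) => i.val ≤ m), g i (η i)) *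
        ∏ i ∈ Finset.univ.filter (fun i : Fin (n + 2) => m + 1 ≤ i.val), g i (η i) := by
    intro η
    rw [← Finset.prod_filter_mul_prod_filter_not Finset.univ (fun i : Fin (n + 2) => i.val ≤ m)]
    congr 1
    exact Finset.prod_congr (Finset.filter_congr fun i _ => by omega) fun _ _ => rfl
  have hbond : ∀ η : Fin (n + 2) → X, ∏ l : Fin (n + 1), b l (η l.castSucc) (η l.succ) =
      (∏ l ∈ Finset.univ.filter (fun l : Fin (n + 1) => l.val < m), b l (η l.castSucc) (η l.succ)) *
        b k (η a) (η j) *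
        ∏ l ∈ Finset.univ.filter (fun l : Fin (n + 1) => m + 1 ≤ l.val),
          b l (η l.castSucc) (η l.succ) := by
    intro η
    rw [prod_bond_split (fun l => b l (η l.castSucc) (η l.succ)) k]
    congr 2
  have hsplit : (fun φ : Fin (n + 2) → X => (∏ i, g i (φ i)) *
      (∏ l : Fin (n + 1), b l (φ l.castSucc) (φ l.succ)) * bc (φ (Fin.last (n + 1))) (φ 0)) =
      fun η => b k (η a) (η j) * w₁ η * w₂ η := by
    funext η
    rw [hsite, hbond]
    simp only [w₁, w₂]
    ring
  rw [hsplit]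
  -- hypotheses of the bond theorem
  have has : a ∉ s := by simp [hsdef]
  have hjs : j ∉ s := by rw [hmem_s]; omega
  have hja : j ≠ a := fun h => by have := congrArg Fin.val h; omega
  have hw₁ : DependsOn w₁ ({i : Fin (n + 2) | i.val ≤ m} ∪ {Fin.last (n + 1), 0}) := by
    intro η η' h
    simp only [w₁]
    congr 1
    · congr 1
      · exact Finset.prod_congr rfl fun i hi => by rw [h i (Or.inl (by simpa using hi))]
      · refine Finset.prod_congr rfl fun l hl => ?_
        have hl' : l.val < m := by simpa using hl
        rw [h l.castSucc (Or.inl (by simp; omega)), h l.succ (Or.inl (by simp; omega))]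
    · rw [h _ (Or.inr (by simp)), h 0 (Or.inr (by simp))]
  have hjV₁ : j ∉ ({i : Fin (n + 2) | i.val ≤ m} ∪ {Fin.last (n + 1), 0} : Set (Fin (n + 2))) := by
    simp only [Set.mem_union, Set.mem_setOf_eq, Set.mem_insert_iff, Set.mem_singleton_iff, not_or]
    refine ⟨by omega, fun h => ?_, fun h => ?_⟩
    · have h1 := congrArg Fin.val h; rw [hj_val, Fin.val_last] at h1; omega
    · have h1 := congrArg Fin.val h; rw [hj_val, Fin.val_zero] at h1; omega
  have hw₂ : DependsOn w₂ {i : Fin (n + 2) | m + 1 ≤ i.val} := by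
    intro η η' h
    simp only [w₂]
    congr 1
    · exact Finset.prod_congr rfl fun i hi => by rw [h i (by simpa using hi)]
    · refine Finset.prod_congr rfl fun l hl => ?_
      have hl' : m + 1 ≤ l.val := by simpa using hl
      rw [h l.castSucc (by simp; omega), h l.succ (by simp; omega)]
  have haV₂ : a ∉ {i : Fin (n + 2) | m + 1 ≤ i.val} := by simp [ha_val]
  have hsV₂ : ∀ i ∈ s, i ∉ {i : Fin (n + 2) | m + 1 ≤ i.val} := by
    intro i hi; have := (hmem_s i).1 hi; simp; omega
  -- positivity, measurability, bounds
  have hw₁pos : ∀ η, 0 < w₁ η := fun η =>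
    mul_pos (mul_pos (Finset.prod_pos fun i _ => hgpos i _) (Finset.prod_pos fun l _ => hbpos l _ _))
      (hbcpos _ _)
  have hw₂pos : ∀ η, 0 < w₂ η := fun η =>
    mul_pos (Finset.prod_pos fun i _ => hgpos i _) (Finset.prod_pos fun l _ => hbpos l _ _)
  have hgm' : ∀ i, Measurable fun η : Fin (n + 2) → X => g i (η i) :=
    fun i => (hgm i).comp (measurable_pi_apply i)
  have hbm' : ∀ l : Fin (n + 1),
      Measurable fun η : Fin (n + 2) → X => b l (η l.castSucc) (η l.succ) := fun l =>
    show Measurable (uncurry (b l) ∘ fun η : Fin (n + 2) → X => (η l.castSucc, η l.succ)) from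
      (hbm l).comp ((measurable_pi_apply _).prodMk (measurable_pi_apply _))
  have hbc' : Measurable fun η : Fin (n + 2) → X => bc (η (Fin.last (n + 1))) (η 0) :=
    show Measurable (uncurry bc ∘ fun η : Fin (n + 2) → X => (η (Fin.last (n + 1)), η 0)) from
      hbcm.comp ((measurable_pi_apply _).prodMk (measurable_pi_apply _))
  have hw₁m : Measurable w₁ :=
    ((Finset.measurable_prod _ fun i _ => hgm' i).mul (Finset.measurable_prod _ fun l _ => hbm' l)).mul
      hbc'
  choose Cg hCg using hgbdd
  choose Cb hCb using hbbdd
  obtain ⟨Cc, hCc⟩ := hbcbdd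
  have hint : ∀ (t : Finset (Fin (n + 2))) (φ : Fin (n + 2) → X) {W : (Fin (n + 2) → X) → ℝ},
      Measurable W → (∀ η, 0 < W η) → (∃ C, ∀ η, W η ≤ C) →
        Integrable (fun η : Fin (n + 2) → X => W (t.piecewise η φ)) (Measure.pi fun _ => μ) := by
    intro t φ W hWm hWpos hWC
    obtain ⟨C, hC⟩ := hWC
    refine Integrable.mono' (integrable_const C)
      ((hWm.comp (measurable_piecewise_left t φ)).aestronglyMeasurable) (ae_of_all _ fun η => ?_)
    rw [Real.norm_eq_abs, abs_of_pos (hWpos _)]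
    exact hC _
  have hw₁bdd : ∃ C, ∀ η, w₁ η ≤ C := by
    refine ⟨(∏ i ∈ Finset.univ.filter (fun i : Fin (n + 2) => i.val ≤ m), Cg i) *
      (∏ l ∈ Finset.univ.filter (fun l : Fin (n + 1) => l.val < m), Cb l) * Cc, fun η => ?_⟩
    have h0 : 0 ≤ ∏ i ∈ Finset.univ.filter (fun i : Fin (n + 2) => i.val ≤ m), Cg i :=
      Finset.prod_nonneg fun i _ => (hgpos i (η i)).le.trans (hCg i _)
    exact mul_le_mul (mul_le_mul (Finset.prod_le_prod (fun i _ => (hgpos i _).le) fun i _ => hCg i _)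
      (Finset.prod_le_prod (fun l _ => (hbpos l _ _).le) fun l _ => hCb l _ _)
      (Finset.prod_nonneg fun l _ => (hbpos l _ _).le) h0) (hCc _ _) (hbcpos _ _).le
      (mul_nonneg h0 (Finset.prod_nonneg fun l _ => (hbpos l (η l.castSucc) (η l.succ)).le.trans
        (hCb l _ _)))
  have hG : ∀ ψ, coordAvg μ s w₁ ψ ≠ 0 := fun ψ =>
    (coordAvg_pos_of_pos μ _ hw₁pos ψ (hint _ ψ hw₁m hw₁pos hw₁bdd)).ne'
  have hWm : Measurable fun η : Fin (n + 2) → X => b k (η a) (η j) * w₁ η * w₂ η := by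
    rw [← hsplit]
    exact ((Finset.measurable_prod _ fun i _ => hgm' i).mul
      (Finset.measurable_prod _ fun l _ => hbm' l)).mul hbc'
  have hWpos : ∀ η : Fin (n + 2) → X, 0 < b k (η a) (η j) * w₁ η * w₂ η := by
    intro η
    rw [← congrFun hsplit η]
    exact mul_pos (mul_pos (Finset.prod_pos fun i _ => hgpos i _)
      (Finset.prod_pos fun l _ => hbpos l _ _)) (hbcpos _ _)
  have hWbdd : ∃ C, ∀ η : Fin (n + 2) → X, b k (η a) (η j) * w₁ η * w₂ η ≤ C := by
    refine ⟨(∏ i, Cg i) * (∏ l, Cb l) * Cc, fun η => ?_⟩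
    rw [← congrFun hsplit η]
    have h0 : 0 ≤ ∏ i, Cg i := Finset.prod_nonneg fun i _ => (hgpos i (η i)).le.trans (hCg i _)
    exact mul_le_mul (mul_le_mul (Finset.prod_le_prod (fun i _ => (hgpos i _).le) fun i _ => hCg i _)
      (Finset.prod_le_prod (fun l _ => (hbpos l _ _).le) fun l _ => hCb l _ _)
      (Finset.prod_nonneg fun l _ => (hbpos l _ _).le) h0) (hCc _ _) (hbcpos _ _).le
      (mul_nonneg h0 (Finset.prod_nonneg fun l _ =>
        (hbpos l (η l.castSucc) (η l.succ)).le.trans (hCb l _ _)))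
  have hM : ∀ ψ, coordAvg μ (insert a s) (fun η => b k (η a) (η j) * w₁ η * w₂ η) ψ ≠ 0 := fun ψ =>
    (coordAvg_pos_of_pos μ _ hWpos ψ (hint _ ψ hWm hWpos hWbdd)).ne'
  exact arConditional_reads_bond μ s has hjs hja (b k) hw₁ hjV₁ hw₂ haV₂ hsV₂
    (fun ψ => (hw₂pos ψ).ne') hG hM hF

end Summit.Ventures.LatticeQCDFlow.Theory2.Autoregressive

end
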